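import Mathlib.Topology.Algebra.Group.Basic
import Literature.AnabelianGeometry.SemiGraphs.SubgroupPresentationArithCompat
import HarnessLib

/-!
# The verticially generated part of a level is stable under compatible automorphisms ([SemiAnbd] Thm 3.7 (iv), §5 p. 66)

Mochizuki, *Semi-graphs of anabelioids*, Publ. RIMS **42** (2006), Thm. 3.7 (iv) p. 41 (isomorphisms of
tempered fundamental groups arising from semi-graphs of anabelioids carry verticial subgroups to verticial
subgroups) and §5 proof of Thm. 5.4 p. 66 ("natural compatible actions of `H` on `𝔾`, `𝔾_i`": the
graph-universal coverings of the `H`-stable finite levels are again `H`-stable)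
[cite: MochizukiSemiAnbd2006, Thm 5.4, p. 66].

PURE GROUP THEORY (cell row T54-B, tower third, file T4a; plan/GAP-LEDGER.md G-w4d053-1, residual E1).
For a subgroup presentation `P` of `𝔾` in a topological group `Γ` and a level `N ≤ Γ`, the subgroup
`P.vertSup N := ⨆_{w, g} N ⊓ g H_w g⁻¹` generated by the VERTEX GROUPS OF THE LEVEL and its closure
`P.vertGen N`.  If `E` acts on `Γ` (`Φ`) and `𝔾` (`σ`) arithmetically compatibly with `P`
(`IsArithCompatible`: `Φ_e(H_w) = k H_{σ_e w} k⁻¹`), then every `Φ_e` stabilising `N` stabilises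
`P.vertSup N` (`map_vertSup_le`), and every CONTINUOUS such `Φ_e` stabilises `P.vertGen N`
(`vertGen_stable`).  This REDUCES the `Φ`-stability of the tree levels `ker ρ_n` of the arithmetic tower
(binder `hK` of `ArithTreeTower.lean`) to that of the finite levels `ker π_n` (binder `hN` of
`ArithLevelTower.lean`) modulo the identity `ker ρ_n = P.vertGen (ker π_n)` ("the kernel of
`π₁^temp(𝒢_i) ↠ π₁(𝔾_i)` is topologically generated by the verticial subgroups").  Nothing here bears on
[IUTchIII] Cor. 3.12.
-/

namespace Literature.AnabelianGeometry.SemiGraphs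

namespace SemiGraph

namespace SubgroupPresentation

open Topology

universe u v

variable {𝔾 : SemiGraph.{u}} {Γ : Type u} [Group Γ] {E : Type v} [Group E]
  (P : SubgroupPresentation 𝔾 Γ) {Φ : E →* MulAut Γ} {σ : E →* CategoryTheory.Aut 𝔾}

/-! ### The subgroup generated by the vertex groups of a level -/

/-- **The subgroup of the level `N` generated by its vertex groups**: `⨆_{(w, g)} N ⊓ g H_w g⁻¹` (the
vertex groups of the covering attached to `N` are the `N ∩ g H_w g⁻¹`). [cite: MochizukiSemiAnbd2006, Thm 3.7(iii) p.41] -/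
def vertSup (N : Subgroup Γ) : Subgroup Γ :=
  ⨆ p : 𝔾.Vertex × Γ, N ⊓ (P.H p.1).map (MulAut.conj p.2).toMonoidHom

/-- `vertSup N ≤ N`. [cite: MochizukiSemiAnbd2006, Thm 3.7(iii) p.41] -/
theorem vertSup_le (N : Subgroup Γ) : P.vertSup N ≤ N :=
  iSup_le fun _ => inf_le_left

/-- The pieces: `N ∩ g H_w g⁻¹ ≤ vertSup N`. [cite: MochizukiSemiAnbd2006, Thm 3.7(iii) p.41] -/
theorem inf_map_conj_le_vertSup (N : Subgroup Γ) (w : 𝔾.Vertex) (g : Γ) :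
    N ⊓ (P.H w).map (MulAut.conj g).toMonoidHom ≤ P.vertSup N :=
  le_iSup (fun p : 𝔾.Vertex × Γ => N ⊓ (P.H p.1).map (MulAut.conj p.2).toMonoidHom) (w, g)

/-- `vertSup` is monotone in the level. [cite: MochizukiSemiAnbd2006, Thm 3.7(iii) p.41] -/
theorem vertSup_mono {N N' : Subgroup Γ} (h : N ≤ N') : P.vertSup N ≤ P.vertSup N' :=
  iSup_le fun p => le_trans (inf_le_inf_right _ h) (P.inf_map_conj_le_vertSup N' p.1 p.2)

/-- **A compatible automorphism `Φ_e` stabilising the level `N` stabilises `vertSup N`**: `Φ_e` carries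
`N ∩ g H_w g⁻¹` into `N ∩ (Φ_e(g) k) H_{σ_e w} (Φ_e(g) k)⁻¹` for a vertex conjugator `k` of `e` at `w`.
[cite: MochizukiSemiAnbd2006, Thm 5.4, p. 66] -/
theorem map_vertSup_le (hP : P.IsArithCompatible Φ σ) {N : Subgroup Γ} {e : E}
    (hN : ∀ x, x ∈ N → Φ e x ∈ N) : (P.vertSup N).map (Φ e).toMonoidHom ≤ P.vertSup N := by
  unfold vertSup
  rw [Subgroup.map_iSup]
  refine iSup_le fun p => ?_
  obtain ⟨k, hk⟩ := hP.exists_isVConj e p.1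
  refine le_trans ?_ (P.inf_map_conj_le_vertSup N ((σ e).hom.vertexMap p.1) (Φ e p.2 * k))
  rintro _ ⟨y, ⟨hyN, hyH⟩, rfl⟩
  refine ⟨hN y hyN, ?_⟩
  obtain ⟨h, hh, rfl⟩ := hyH
  refine ⟨k⁻¹ * Φ e h * k, (hk h).mp hh, ?_⟩
  simp only [MulEquiv.coe_toMonoidHom, MulAut.conj_apply]
  rw [map_mul, map_mul, map_inv]
  group

/-- Pointwise form. [cite: MochizukiSemiAnbd2006, Thm 5.4, p. 66] -/
theorem vertSup_stable (hP : P.IsArithCompatible Φ σ) {N : Subgroup Γ} {e : E}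
    (hN : ∀ x, x ∈ N → Φ e x ∈ N) {x : Γ} (hx : x ∈ P.vertSup N) : Φ e x ∈ P.vertSup N :=
  P.map_vertSup_le hP hN ⟨x, hx, rfl⟩

/-! ### Its closure -/

variable [TopologicalSpace Γ] [IsTopologicalGroup Γ]

/-- **The verticially generated part of the level `N`**: the closure of `vertSup N`.
[cite: MochizukiSemiAnbd2006, Thm 3.7(iii) p.41] -/
def vertGen (N : Subgroup Γ) : Subgroup Γ := (P.vertSup N).topologicalClosure

/-- `vertSup N ≤ vertGen N`. [cite: MochizukiSemiAnbd2006, Thm 3.7(iii) p.41] -/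
theorem vertSup_le_vertGen (N : Subgroup Γ) : P.vertSup N ≤ P.vertGen N :=
  Subgroup.le_topologicalClosure _

/-- `vertGen N ≤ N` for a closed level. [cite: MochizukiSemiAnbd2006, Thm 3.7(iii) p.41] -/
theorem vertGen_le (N : Subgroup Γ) (hN : IsClosed (N : Set Γ)) : P.vertGen N ≤ N :=
  Subgroup.topologicalClosure_minimal _ (P.vertSup_le N) hN

/-- `vertGen N` is closed. [cite: MochizukiSemiAnbd2006, Thm 3.7(iii) p.41] -/
theorem isClosed_vertGen (N : Subgroup Γ) : IsClosed (P.vertGen N : Set Γ) :=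
  Subgroup.isClosed_topologicalClosure _

/-- `vertGen` is the least closed subgroup containing the vertex groups of the level.
[cite: MochizukiSemiAnbd2006, Thm 3.7(iii) p.41] -/
theorem vertGen_le_of_le {N V : Subgroup Γ} (hV : IsClosed (V : Set Γ)) (h : P.vertSup N ≤ V) :
    P.vertGen N ≤ V :=
  Subgroup.topologicalClosure_minimal _ h hV

/-- `vertGen` is monotone in the level. [cite: MochizukiSemiAnbd2006, Thm 3.7(iii) p.41] -/
theorem vertGen_mono {N N' : Subgroup Γ} (h : N ≤ N') : P.vertGen N ≤ P.vertGen N' :=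
  Subgroup.topologicalClosure_mono (P.vertSup_mono h)

/-- **A CONTINUOUS compatible automorphism `Φ_e` stabilising the level `N` stabilises `vertGen N`** (so the
`Φ`-stability of the tree levels of the arithmetic tower follows from that of the finite levels, once
`ker ρ_n = vertGen (ker π_n)`). [cite: MochizukiSemiAnbd2006, Thm 5.4, p. 66] -/
theorem vertGen_stable (hP : P.IsArithCompatible Φ σ) {N : Subgroup Γ} {e : E}
    (hN : ∀ x, x ∈ N → Φ e x ∈ N) (hc : Continuous (Φ e)) {x : Γ} (hx : x ∈ P.vertGen N) :
    Φ e x ∈ P.vertGen N := by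
  have h1 : (Φ e) '' (P.vertSup N : Set Γ) ⊆ (P.vertSup N : Set Γ) := by
    rintro _ ⟨y, hy, rfl⟩
    exact P.vertSup_stable hP hN hy
  have h2 : Φ e x ∈ closure ((Φ e) '' (P.vertSup N : Set Γ)) :=
    image_closure_subset_closure_image hc ⟨x, hx, rfl⟩
  exact closure_mono h1 h2

/-- The same for a family of levels: if every `Φ_e` is continuous and stabilises every `N n`, then every
`Φ_e` stabilises every `vertGen (N n)` (the shape of the binders `hK`/`hN` of the arithmetic tower).
[cite: MochizukiSemiAnbd2006, Thm 5.4, p. 66] -/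
theorem vertGen_stable_family (hP : P.IsArithCompatible Φ σ) {ι : Type*} (N : ι → Subgroup Γ)
    (hN : ∀ (n : ι) (e : E) (x : Γ), x ∈ N n → Φ e x ∈ N n) (hc : ∀ e : E, Continuous (Φ e))
    (n : ι) (e : E) (x : Γ) (hx : x ∈ P.vertGen (N n)) : Φ e x ∈ P.vertGen (N n) :=
  P.vertGen_stable hP (hN n e) (hc e) hx

end SubgroupPresentation

end SemiGraph

end Literature.AnabelianGeometry.SemiGraphs
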